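import Summits.QuantumFields.YangMills.Theorems.UnitScaleTiltProp7OneFormKatoBootstrap
import Literature.MathematicalPhysics.QuantumFieldTheory.Balaban1983to89.B9Eq342SupNormBootstrapWeightedChain
import Literature.MathematicalPhysics.QuantumFieldTheory.Balaban1983to89.B5Eq129FreeResolventDecayedLetterSiteDiag
import HarnessLib

/-!
# Route `UnitScaleTilt`, crux K1 «MinimiserStabilityRegPr» (stmt-QuantumFields-19200), EX face S45 — (L3′b)-VALUE, ONE-FORM STOREY, FILE O3d:
# **THE WEIGHTED KATO BOOTSTRAP (DECAY EDITION) FOR THE MEMBER's ONE-FORM OPERATOR `Δ_a = Δx + D R_S D* + Q*aQ` ON THE BOND GRAPH** — V3's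
# ✓`Prop7KatoBootstrapMemberDecay.norm_apply_le_of_kato_member_weighted` with `ι := Bond 3 (periodsT3 F K)` in place of `TSite`

Cell `ym3-torus` (HUMAN RULING D-0037; rung R3 = SU(2) YM₃ on T³ — NOT d = 4, NOT infinite volume, NOT a mass gap, NOT Clay).  Chair ★`ym-ust-19200-p1` g26 CHAIR WORD №7 open pen
(O3d), typed by `prover ym-line-cst-p1` g35 (FREE hands; `--supports stmt-QuantumFields-19200 --as helper`).  THEOREMS ONLY (0 `def`, 0 `sorry`, default heartbeats); count-neutral.

WHY.  O2 (✓`Prop7OneFormKatoBootstrap`) put V1's Kato graph ON THE BONDS (`ι := Bond`, `J := Fin 3 ⊕ Fin 3`, neighbours `(y ∓ e_ν, μ)`, transporters `R(U₀)⁻¹`, `R(U₀)` — Frobenius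
isometries), read the member's `Δ_a(U₀)u = f` as the Kato form `Σ_j ℓ²•(u(p) − T_j u(nbr_j p)) = f(p) − q(p)` with the displayed four-term remainder `q` (✓`kato_sum_eq_vecLap` +
✓`symm_laplaceA_toL2_apply` + ✓`covLapFormT_one_eq`), and ran the UNWEIGHTED bootstrap.  V3 (✓`Prop7KatoBootstrapMemberDecay`) is the WEIGHTED (decay) edition on the SITE graph.  THIS FILE
is V3's bond twin: the weighted three-domination bootstrap lit ✓`B9Eq342SupNormBootstrapWeightedChain.norm_le_of_kato_bootstrap_weighted_chain_centre` (`k := 3`, `m := 1`) on the bond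
graph, with the decayed free letter lit ✓`B5Eq129FreeResolventDecayedLetterSiteDiag.chain_apply_le_weighted_site_diag` transported to the bond graph COMPONENT BY COMPONENT (the bond graph is
three decoupled copies of the site graph: `nbr` keeps the direction index `μ`, so the restriction of a bond chain ∕ bond weight to the component `μ` is a site chain ∕ site weight — O2's
✓`hFS_bond` reduction), for EVERY bond weight `W > 0` obeying the supersolution inequality on the bond graph.
WHAT IS PROVED (ns `Summit.QuantumFields.YangMills.Theorems.Prop7OneFormKatoBootstrapDecay`; member `F`, `n ≤ K`, `ℓ = L^{K−n} = η⁻¹`).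
* §1 ★ `chain_apply_le_weighted_bond_diag` — the decayed free letter ON THE BOND GRAPH (`d = 3`, unit mass, diagonal `c₀t³ = c₁`, `t ≤ P_ν`, `k ≥ 3`): for a bond weight `W > 0` with
  `λW ≤ (L₀+1)W` and a resolvent chain `(L₀+1)φ_{j+1} = φ_j`, `φ_k(p₀) ≤ √(3³∕c₁·(λ^k)⁻¹·W(p₀))·√(Σ_p c₀φ₀(p)²∕W(p))`.
* §2 ★★ `norm_apply_le_of_katoForm_bond_weighted` — V3 VERBATIM on the bond graph, for functions `u f q : Bond → W₂` under the displayed Kato form at ANY `U₀`: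
  `‖u(p₀)‖ ≤ s·Σ_{l<3}(1∕λ)^l + √(3³∕(c₀ℓ³)·(λ³)⁻¹)·√(Σ_p c₀‖u(p)‖²∕W(p))` from `W(p₀) = 1`, `λW ≤ (L₀+1)W`, `‖f(p)‖ + ‖q(p)‖ ≤ s·λ·W(p)`; `…_of_letter` with `√(…) ≤ E_W`.
* §3 ★★★ `norm_apply_le_of_kato_oneForm_weighted` — THE MEMBER EDITION: ANY `U₀` (no `RegPr`: the local remainder is DATA here), ANY slot `Δx`, `u f ∈ L²` with `Δ_a(U₀)u = f`, the
  remainder `q` DISPLAYED as O2's four-term function `aQ_k†Q_k u − D(1−R_S)D*u + (Δx − Δ^η)u + η⁻²(Δ′₁ − 𝒦)(toL2⁻¹u)` (hypothesis `hq`), weight∕data letters as in §2 ⟹ the same bound for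
  `‖u(p₀)‖`; `…_of_letter` with `E_W`.  The Kato form is PROVED inside (O2's derivation).
LETTERS LEFT DISPLAYED (for O4, the chair's consumer): the weight (V4b-1 ✓`Prop7MemberCoshWeight.weight_supersolution_member` for a site weight `W (y,μ) := Ws y`), the data domination
`‖f‖ + ‖q‖ ≤ sλW` (block support of `f` + the (D)∕(Q)∕(X)∕local letters against the weight), and `E_W` (A4 + V4b-1 ✓`exp_blockDist_le_weight`).
HONEST SCOPE.  A composition of lit engines at O2's letters; CONDITIONAL on the displayed weight and data letters; nothing of the ten EX rows, `hT`, Thm 3.12 for print's `G`∕`H`, EX or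
the crux is proved here; no summit is proved by a helper.

References: T. Bałaban, CMP **99** (1985) 389–434 [Balaban1985BackgroundPropagators] (Thm 3.1 (3.42) p.397, (3.23)–(3.25) p.394, (3.11) p.392, (3.39) p.397, Thm 3.12 p.422);
CMP **102** (1985) 277–309 [Balaban1985Variational] ((134)–(136) p.298); CMP **95** (1984) 17–40 [Balaban1984PropagatorsI] ((1.29) p.23, Prop. 1.1 p.33, p.36).
-/

set_option autoImplicit false

noncomputable section

open scoped Matrix.Norms.L2Operator BigOperators InnerProductSpace ComplexConjugate

open Literature.MathematicalPhysics.QuantumFieldTheory.Balaban1983to89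
open Literature.MathematicalPhysics.QuantumFieldTheory.Balaban1983to89.T3ContinuumYM3Torus
open T3SectALandauChart (formComp bgUnits covLapFormT eta eta_pos)
open B4Sect5Torus (TSite)
open B9SectCLatticeCarrier (Bond shift unshift)
open B9Eq311L2Pairing (WL2)
open B9TorusCalculus (torusT torusT_apply torusT_symm_apply torusT_comm)
open B9Eq310Hermitian (deltaPrimeOp)
open B11Eq135Weitzenbock (vecLap curvOp vecLap_def covDstar_covD)
open B11Eq103H1Complex (SiteL2K BondL2K)
open B9Eq342SupNormBootstrapWeightedChain (exists_scalar_chain norm_le_of_kato_bootstrap_weighted_chain_centre)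
open B5Eq129FreeResolventDecayedLetterSiteDiag (chain_apply_le_weighted_site_diag)
open Summit.QuantumFields.YangMills.Theorems.Prop7SectET3Transport (periodsT3 siteEquiv bondEquiv bgOfCfg siteEquiv_symm_shift bondEquiv_apply)
open Summit.QuantumFields.YangMills.Theorems.Prop7SectET3HilbertLetters (W₂ frobEquiv adW adBg adBgInv toL2 DL2 DstarL2 frobEquiv_adW toL2_symm_apply)
open Summit.QuantumFields.YangMills.Theorems.Prop7SectET3WilsonHessian (DeltaEta DeltaEtaSlot DeltaEtaSlot_apply)
open Summit.QuantumFields.YangMills.Theorems.Prop7SectET3GaugeProjector (RS)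
open Summit.QuantumFields.YangMills.Theorems.Prop7SectET3CurvedPropagators (laplaceA Qk)
open Summit.QuantumFields.YangMills.Theorems.Prop7SecondOrderDict (covLapFormT_one_eq)
open Summit.QuantumFields.YangMills.Theorems.Prop7KatoBootstrapMember (norm_adBg_eq norm_adBgInv_eq eta_inv_le_periods)
open Summit.QuantumFields.YangMills.Theorems.Prop7OneFormKatoForm (symm_laplaceA_toL2_apply)
open Summit.QuantumFields.YangMills.Theorems.Prop7OneFormKatoBootstrap (equiv_apply_eq kato_sum_eq_vecLap norm_eq_sqrt_sum_bond)

namespace Summit.QuantumFields.YangMills.Theorems.Prop7OneFormKatoBootstrapDecay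

/-! ## §1 The decayed free letter on the bond graph -/

/-- ★ **THE DECAYED FREE LETTER ON THE BOND GRAPH** (`d = 3`, unit mass, diagonal `c₀t³ = c₁`, `t ≤ P_ν`, `k ≥ 3`): for a bond weight `W > 0` with `λ·W ≤ (L₀ + 1)W` for the flat
`t²`-stencil of the bond graph (neighbours `(y ∓ e_ν, μ)` — three decoupled copies of the site graph) and a resolvent chain `(L₀ + 1)φ_{j+1} = φ_j` (`j < k`),
`φ_k(p₀) ≤ √(3³∕c₁·(λ^k)⁻¹·W(p₀))·√(Σ_p c₀φ₀(p)²∕W(p))` — lit ✓`chain_apply_le_weighted_site_diag` on the component `μ := p₀.2` (the restrictions of `W` and of the chain to a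
component are a site weight ∕ site chain because `nbr` keeps `μ`), then the component sum is below the full sum (terms `≥ 0`).
[cite: Balaban1984PropagatorsI, (1.29) p.23, Prop. 1.1 p.33; Balaban1985BackgroundPropagators, (3.39) p.397, (3.42) p.397] -/
theorem chain_apply_le_weighted_bond_diag (F : T3Family) (K : ℕ) {k : ℕ} (hk : 3 ≤ k) {t c₀ c₁ lam : ℝ} (ht : 0 < t) (hc₀ : 0 < c₀) (hc₁ : c₀ * t ^ 3 = c₁)
    (hvol : ∀ ν, t ≤ ((periodsT3 F K ν : ℕ) : ℝ)) (hlam : 0 < lam) {W : Bond 3 (periodsT3 F K) → ℝ} (hW : ∀ p, 0 < W p)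
    (hsup : ∀ p, lam * W p ≤ ∑ j : Fin 3 ⊕ Fin 3, t ^ 2 * (W p - W (Sum.elim (fun ν => unshift ν p.1) (fun ν => shift ν p.1) j, p.2)) + 1 * W p)
    {φ : ℕ → Bond 3 (periodsT3 F K) → ℝ}
    (hφ : ∀ j < k, ∀ p, ∑ i : Fin 3 ⊕ Fin 3, t ^ 2 * (φ (j + 1) p - φ (j + 1) (Sum.elim (fun ν => unshift ν p.1) (fun ν => shift ν p.1) i, p.2)) +
      1 * φ (j + 1) p = φ j p) (p₀ : Bond 3 (periodsT3 F K)) :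
    φ k p₀ ≤ Real.sqrt (3 ^ 3 / c₁ * (lam ^ k)⁻¹ * W p₀) * Real.sqrt (∑ p, c₀ * φ 0 p ^ 2 / W p) := by
  obtain ⟨y, μ⟩ := p₀
  -- the component `μ`: a site weight and a site chain
  have hWμ : ∀ z : TSite 3 (periodsT3 F K), 0 < W (z, μ) := fun z => hW _
  have hsupμ : ∀ z : TSite 3 (periodsT3 F K), lam * W (z, μ) ≤
      ∑ j : Fin 3 ⊕ Fin 3, t ^ 2 * (W (z, μ) - W (Sum.elim (fun ν => unshift ν z) (fun ν => shift ν z) j, μ)) + 1 * W (z, μ) :=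
    fun z => hsup (z, μ)
  have hφμ : ∀ j < k, ∀ z : TSite 3 (periodsT3 F K),
      ∑ i : Fin 3 ⊕ Fin 3, t ^ 2 * (φ (j + 1) (z, μ) - φ (j + 1) (Sum.elim (fun ν => unshift ν z) (fun ν => shift ν z) i, μ)) +
        1 * φ (j + 1) (z, μ) = φ j (z, μ) :=
    fun j hj z => hφ j hj (z, μ)
  have hS := chain_apply_le_weighted_site_diag (periodsT3 F K) (d := 3) hk ht hc₀ hc₁ hvol hlam (W := fun z => W (z, μ)) hWμ hsupμ
    (φ := fun j z => φ j (z, μ)) hφμ y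
  -- the component sum is below the full sum
  refine hS.trans (mul_le_mul_of_nonneg_left (Real.sqrt_le_sqrt ?_) (Real.sqrt_nonneg _))
  rw [Fintype.sum_prod_type]
  refine Finset.sum_le_sum fun z _ => ?_
  have hz : c₀ * φ 0 (z, μ) ^ 2 / W (z, μ) = ∑ ν ∈ ({μ} : Finset (Fin 3)), c₀ * φ 0 (z, ν) ^ 2 / W (z, ν) := by rw [Finset.sum_singleton]
  rw [hz]
  exact Finset.sum_le_sum_of_subset_of_nonneg (Finset.subset_univ _) fun ν _ _ => div_nonneg (by positivity) (hW _).le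

/-! ## §2 The weighted bootstrap on the bond graph, Kato-form edition (any `U₀`) -/

variable (F : T3Family) (n K : ℕ) (c₀ : ℝ) [Fact (0 < c₀)]

/-- ★★ **THE WEIGHTED KATO BOOTSTRAP (DECAY EDITION) ON THE BOND GRAPH OF THE MEMBER, KATO-FORM EDITION — EVERY BACKGROUND, EVERY REMAINDER, EVERY SUPERSOLUTION WEIGHT.**
Let `U₀` be ANY configuration of the finest lattice of the member `(F, n ≤ K)`, `u f q : Bond → W₂` with the Kato form
`Σ_{j : Fin 3 ⊕ Fin 3} ℓ²•(u(p) − T_j u(nbr_j p)) = f(p) − q(p)` (`nbr_j(y,μ) = (y ∓ e_ν, μ)`, `T = R(U₀(y−e_ν,ν))⁻¹ ⊕ R(U₀(y,ν))`, `ℓ = η⁻¹`), `W > 0` a weight on the bonds with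
`W(p₀) = 1` and `λ·W ≤ (L₀ + 1)W` for the flat `ℓ²`-stencil of the bond graph (`0 < λ`), and data dominated by the weight: `‖f(p)‖ + ‖q(p)‖ ≤ s·λ·W(p)` (`0 ≤ s`).  Then
`‖u(p₀)‖ ≤ s·Σ_{l<3}(1∕λ)^l + √(3³∕(c₀·(L^{K−n})³)·(λ³)⁻¹)·√(Σ_p c₀‖u(p)‖²∕W(p))`.
Lit ✓`norm_le_of_kato_bootstrap_weighted_chain_centre` (`k := 3`, `m := 1`, isometric transporters ✓`norm_adBg_eq`∕✓`norm_adBgInv_eq`) with the chain of lit ✓`exists_scalar_chain` and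
§1 at the diagonal `c₁ = c₀ℓ³` (level-free).  V3's ✓`norm_apply_le_of_kato_member_weighted` VERBATIM with `ι := Bond`.  CONDITIONAL on the displayed Kato form, weight and data letters.
[cite: Balaban1985BackgroundPropagators, Thm 3.1 (3.42) p.397, (3.23)–(3.25) p.394, (3.11) p.392; Balaban1984PropagatorsI, (1.29) p.23, Prop. 1.1 p.33, p.36] -/
theorem norm_apply_le_of_katoForm_bond_weighted (hnK : n ≤ K) (U₀ : GaugeField (F.P K) 0 (Matrix.specialUnitaryGroup (Fin 2) ℂ))
    {u f q : Bond 3 (periodsT3 F K) → W₂}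
    (hu' : ∀ p : Bond 3 (periodsT3 F K), ∑ j : Fin 3 ⊕ Fin 3, (((eta F n K)⁻¹ ^ 2 : ℝ) : ℂ) • (u p -
        Sum.elim (fun ν => adBgInv F K U₀ (unshift ν p.1, ν)) (fun ν => adBg F K U₀ (p.1, ν)) j
          (u (Sum.elim (fun ν => unshift ν p.1) (fun ν => shift ν p.1) j, p.2))) = f p - q p)
    {W : Bond 3 (periodsT3 F K) → ℝ} {lam : ℝ} (hlam : 0 < lam) (hW : ∀ p, 0 < W p)
    (hsup : ∀ p, lam * W p ≤ ∑ j : Fin 3 ⊕ Fin 3, (eta F n K)⁻¹ ^ 2 * (W p - W (Sum.elim (fun ν => unshift ν p.1) (fun ν => shift ν p.1) j, p.2)) + 1 * W p)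
    {s : ℝ} (hs : 0 ≤ s) (hdata : ∀ p, ‖f p‖ + ‖q p‖ ≤ s * (lam * W p))
    {p₀ : Bond 3 (periodsT3 F K)} (hp₀ : W p₀ = 1) :
    ‖u p₀‖ ≤ s * ∑ l ∈ Finset.range 3, (1 / lam) ^ l
        + Real.sqrt (3 ^ 3 / (c₀ * ((F.L : ℝ) ^ (K - n)) ^ 3) * (lam ^ 3)⁻¹) * Real.sqrt (∑ p, c₀ * ‖u p‖ ^ 2 / W p) := by
  have hc₀ : 0 < c₀ := Fact.out
  -- the difference quotient `t = η⁻¹ = ℓ`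
  set t : ℝ := (eta F n K)⁻¹ with ht_def
  have ht : 0 < t := inv_pos.mpr (eta_pos F n K)
  have htL : t = (F.L : ℝ) ^ (K - n) := by rw [ht_def, eta, inv_pow, inv_inv]
  -- abstract data of the bootstrap on the bond graph (as in O2)
  let nbr : Bond 3 (periodsT3 F K) → Fin 3 ⊕ Fin 3 → Bond 3 (periodsT3 F K) :=
    fun q j => (Sum.elim (fun ν => unshift ν q.1) (fun ν => shift ν q.1) j, q.2)
  let T : Bond 3 (periodsT3 F K) → Fin 3 ⊕ Fin 3 → W₂ →ₗ[ℂ] W₂ :=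
    fun q j => Sum.elim (fun ν => adBgInv F K U₀ (unshift ν q.1, ν)) (fun ν => adBg F K U₀ (q.1, ν)) j
  have hT : ∀ q j w, ‖T q j w‖ ≤ ‖w‖ := fun q j w => by
    rcases j with ν | ν
    · exact (norm_adBgInv_eq F K U₀ _ w).le
    · exact (norm_adBg_eq F K U₀ _ w).le
  have hu'' : ∀ p, ∑ j, (RCLike.ofReal (t ^ 2) : ℂ) • (u p - T p j (u (nbr p j))) = f p - q p := by
    intro p
    rw [← hu' p]
    refine Finset.sum_congr rfl fun j _ => ?_
    rcases j with ν | ν <;> rfl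
  -- the supersolution and the data in the bootstrap's currency (`w p j = t²`, `m = 1`)
  have hw : ∀ (p : Bond 3 (periodsT3 F K)) (j : Fin 3 ⊕ Fin 3), (0 : ℝ) ≤ t ^ 2 := fun _ _ => sq_nonneg _
  have hsup' : ∀ p, lam * W p ≤ ∑ j, t ^ 2 * (W p - W (nbr p j)) + 1 * W p := fun p => hsup p
  -- the 3-chain `φ₀ = ‖u‖`, `(L₀ + 1)φ_{j+1} = φ_j`
  obtain ⟨φ, hφ0, hφ⟩ := exists_scalar_chain nbr (fun _ _ => t ^ 2) hw one_pos (fun p => ‖u p‖) 3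
  have hφ0' : ∀ p, φ 0 p = ‖u p‖ := fun p => by rw [hφ0]
  -- THE WEIGHTED BOOTSTRAP (three dominations)
  have hboot := norm_le_of_kato_bootstrap_weighted_chain_centre (𝕜 := ℂ) nbr (fun _ _ => t ^ 2) hw T hT one_pos hlam hsup' hu'' hs hdata hφ0' hφ hp₀
  -- THE DECAYED FREE LETTER on the bond graph at the diagonal (`k = d = 3`, `c₁ = c₀t³`, level-free)
  have hvol : ∀ ν, t ≤ ((periodsT3 F K ν : ℕ) : ℝ) := fun ν => eta_inv_le_periods F n K hnK ν
  have hφ' : ∀ j < 3, ∀ p : Bond 3 (periodsT3 F K), ∑ i : Fin 3 ⊕ Fin 3, t ^ 2 * (φ (j + 1) p -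
      φ (j + 1) (Sum.elim (fun ν => unshift ν p.1) (fun ν => shift ν p.1) i, p.2)) + 1 * φ (j + 1) p = φ j p := fun j hj p => hφ j hj p
  have hfree := chain_apply_le_weighted_bond_diag F K (k := 3) le_rfl ht hc₀ (c₁ := c₀ * t ^ 3) rfl hvol hlam hW hsup hφ' p₀
  rw [hp₀, mul_one] at hfree
  simp only [hφ0'] at hfree
  -- assemble
  have h1 : (1 : ℝ) ^ 3 * φ 3 p₀ = φ 3 p₀ := by rw [one_pow, one_mul]
  rw [h1] at hboot
  rw [htL] at hfree
  calc ‖u p₀‖ ≤ s * ∑ l ∈ Finset.range 3, (1 / lam) ^ l + φ 3 p₀ := hboot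
    _ ≤ s * ∑ l ∈ Finset.range 3, (1 / lam) ^ l
        + Real.sqrt (3 ^ 3 / (c₀ * ((F.L : ℝ) ^ (K - n)) ^ 3) * (lam ^ 3)⁻¹) * Real.sqrt (∑ p, c₀ * ‖u p‖ ^ 2 / W p) :=
        add_le_add_right hfree _

/-- ★ **THE KATO-FORM EDITION WITH THE (D-E) SLOT AS ONE LETTER**: same data; if moreover `√(Σ_p c₀‖u(p)‖²∕W(p)) ≤ E_W`, then
`‖u(p₀)‖ ≤ s·Σ_{l<3}(1∕λ)^l + √(3³∕(c₀·(L^{K−n})³)·(λ³)⁻¹)·E_W`.  CONDITIONAL on the displayed letters.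
[cite: Balaban1985BackgroundPropagators, Thm 3.1 (3.42) p.397, (3.11) p.392; Balaban1984PropagatorsI, Prop. 1.1 p.33, p.36] -/
theorem norm_apply_le_of_katoForm_bond_weighted_of_letter (hnK : n ≤ K) (U₀ : GaugeField (F.P K) 0 (Matrix.specialUnitaryGroup (Fin 2) ℂ))
    {u f q : Bond 3 (periodsT3 F K) → W₂}
    (hu' : ∀ p : Bond 3 (periodsT3 F K), ∑ j : Fin 3 ⊕ Fin 3, (((eta F n K)⁻¹ ^ 2 : ℝ) : ℂ) • (u p -
        Sum.elim (fun ν => adBgInv F K U₀ (unshift ν p.1, ν)) (fun ν => adBg F K U₀ (p.1, ν)) j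
          (u (Sum.elim (fun ν => unshift ν p.1) (fun ν => shift ν p.1) j, p.2))) = f p - q p)
    {W : Bond 3 (periodsT3 F K) → ℝ} {lam : ℝ} (hlam : 0 < lam) (hW : ∀ p, 0 < W p)
    (hsup : ∀ p, lam * W p ≤ ∑ j : Fin 3 ⊕ Fin 3, (eta F n K)⁻¹ ^ 2 * (W p - W (Sum.elim (fun ν => unshift ν p.1) (fun ν => shift ν p.1) j, p.2)) + 1 * W p)
    {s : ℝ} (hs : 0 ≤ s) (hdata : ∀ p, ‖f p‖ + ‖q p‖ ≤ s * (lam * W p))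
    {p₀ : Bond 3 (periodsT3 F K)} (hp₀ : W p₀ = 1)
    {EW : ℝ} (hEW : Real.sqrt (∑ p, c₀ * ‖u p‖ ^ 2 / W p) ≤ EW) :
    ‖u p₀‖ ≤ s * ∑ l ∈ Finset.range 3, (1 / lam) ^ l + Real.sqrt (3 ^ 3 / (c₀ * ((F.L : ℝ) ^ (K - n)) ^ 3) * (lam ^ 3)⁻¹) * EW := by
  have h := norm_apply_le_of_katoForm_bond_weighted F n K c₀ hnK U₀ hu' hlam hW hsup hs hdata hp₀
  exact h.trans (add_le_add_right (mul_le_mul_of_nonneg_left hEW (Real.sqrt_nonneg _)) _)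

/-! ## §3 The member edition: `Δ_a(U₀)u = f` with O2's displayed remainder -/

variable {h : n ≤ K} {cB a : ℝ} [Fact (0 < cB)]
  {Δx : GaugeField (F.P K) 0 (Matrix.specialUnitaryGroup (Fin 2) ℂ) → (BondL2K ℂ 3 (periodsT3 F K) c₀ W₂ →ₗ[ℂ] BondL2K ℂ 3 (periodsT3 F K) c₀ W₂)}

/-- ★★ **THE KATO FORM OF `Δ_a(U₀)u = f` ON THE BOND GRAPH** (O2's derivation, isolated): for ANY `U₀`, ANY slot `Δx`, with `X := toL2⁻¹u` and the four-term remainder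
`q(p) = (aQ_k†Q_k u)(p) − (D(1−R_S)D*u)(p) + ((Δx − Δ^η)u)(p) + frobEquiv⁻¹(η⁻²((Δ′₁ − 𝒦)X)_μ(x))` at `p = (y, μ)`, `x = siteEquiv⁻¹ y`,
`Σ_j ℓ²•(u(p) − T_j u(nbr_j p)) = f(p) − q(p)` — ✓`kato_sum_eq_vecLap` + ✓`symm_laplaceA_toL2_apply` + ✓`covLapFormT_one_eq`.
[cite: Balaban1985Variational, (134)–(136) p.298; Balaban1985BackgroundPropagators, (3.23) p.394] -/
theorem katoForm_of_laplaceA (U₀ : GaugeField (F.P K) 0 (Matrix.specialUnitaryGroup (Fin 2) ℂ))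
    {u f : BondL2K ℂ 3 (periodsT3 F K) c₀ W₂} (hu : laplaceA F n K h c₀ cB a Δx U₀ u = f)
    {q : Bond 3 (periodsT3 F K) → W₂}
    (hq : ∀ p, q p = WL2.equiv ℂ _ W₂ (LinearMap.adjoint (Qk F n K h c₀ cB U₀) (((a : ℝ) : ℂ) • Qk F n K h c₀ cB U₀ u)) p
      - WL2.equiv ℂ _ W₂ (DL2 F n K c₀ U₀ (DstarL2 F n K c₀ U₀ u - RS F n K h c₀ cB U₀ (DstarL2 F n K c₀ U₀ u))) p
      + WL2.equiv ℂ _ W₂ ((Δx U₀ - (DeltaEta F n K c₀ U₀ : BondL2K ℂ 3 (periodsT3 F K) c₀ W₂ →ₗ[ℂ] BondL2K ℂ 3 (periodsT3 F K) c₀ W₂)) u) p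
      + frobEquiv.symm ((eta F n K)⁻¹ • (eta F n K)⁻¹ •
          (deltaPrimeOp (torusT (F.P K) 0) (fun ν x => bgUnits F K U₀ ⟨x, ν⟩) 1 (formComp ((toL2 F K c₀).symm u)) p.2 ((siteEquiv F K).symm p.1)
            - curvOp (torusT (F.P K) 0) (fun ν x => bgUnits F K U₀ ⟨x, ν⟩) (formComp ((toL2 F K c₀).symm u)) p.2 ((siteEquiv F K).symm p.1))))
    (p : Bond 3 (periodsT3 F K)) :
    ∑ j : Fin 3 ⊕ Fin 3, (((eta F n K)⁻¹ ^ 2 : ℝ) : ℂ) • (WL2.equiv ℂ _ W₂ u p -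
        Sum.elim (fun ν => adBgInv F K U₀ (unshift ν p.1, ν)) (fun ν => adBg F K U₀ (p.1, ν)) j
          (WL2.equiv ℂ _ W₂ u (Sum.elim (fun ν => unshift ν p.1) (fun ν => shift ν p.1) j, p.2)))
      = WL2.equiv ℂ _ W₂ f p - q p := by
  -- the difference quotient `t = η⁻¹`
  set t : ℝ := (eta F n K)⁻¹ with ht_def
  -- the route reading of `u` and of every `L²` vector at a bond
  set X : PBond (F.P K) 0 → Matrix (Fin 2) (Fin 2) ℂ := (toL2 F K c₀).symm u with hX
  have huX : u = toL2 F K c₀ X := by rw [hX, LinearEquiv.apply_symm_apply]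
  have hread : ∀ (g : BondL2K ℂ 3 (periodsT3 F K) c₀ W₂) (y : TSite 3 (periodsT3 F K)) (μ : Fin 3),
      frobEquiv (WL2.equiv ℂ _ W₂ g (y, μ)) = (toL2 F K c₀).symm g ⟨(siteEquiv F K).symm y, μ⟩ := fun g y μ => by
    rw [toL2_symm_apply, bondEquiv_apply, Equiv.apply_symm_apply]; rfl
  obtain ⟨y, μ⟩ := p
  have hk := kato_sum_eq_vecLap (c₀ := c₀) U₀ u t y μ
  rw [hk, hq]
  apply frobEquiv.injective
  rw [LinearEquiv.apply_symm_apply, map_sub, hread f, ← hu, huX, symm_laplaceA_toL2_apply, covLapFormT_one_eq]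
  simp only [map_add, map_sub, hread, LinearEquiv.apply_symm_apply, LinearEquiv.symm_apply_apply]
  -- the scalar `t² = η⁻¹·η⁻¹` (complex vs real action)
  have hsc : (((t ^ 2 : ℝ) : ℂ)) • vecLap (torusT (F.P K) 0) (fun ν x => bgUnits F K U₀ ⟨x, ν⟩) (formComp X) μ ((siteEquiv F K).symm y)
      = (eta F n K)⁻¹ • (eta F n K)⁻¹ • vecLap (torusT (F.P K) 0) (fun ν x => bgUnits F K U₀ ⟨x, ν⟩) (formComp X) μ ((siteEquiv F K).symm y) := by
    rw [Complex.coe_smul, smul_smul, ht_def, sq]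
  rw [hsc]
  abel

/-- ★★★ **THE WEIGHTED KATO BOOTSTRAP (DECAY EDITION) FOR `Δ_a = Δx + D R_S D* + Q*aQ` AT THE T³ MEMBER, ON THE BOND GRAPH — EVERY BACKGROUND, EVERY SLOT, EVERY SUPERSOLUTION
WEIGHT.**  Let `U₀` be ANY configuration (no regularity is used: the local remainder is DATA here), `Δx` any slot, `u f ∈ L²` vector fields with `Δ_a(U₀)u = f`, and `q` the
DISPLAYED four-term remainder of O2 (`hq`: `aQ_k†Q_k u − D(1−R_S)D*u + (Δx − Δ^η)u + η⁻²(Δ′₁ − 𝒦)(toL2⁻¹u)`, bond by bond).  Let `W > 0` be a weight on the bonds with `W(p₀) = 1` and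
`λ·W ≤ (L₀ + 1)W` for the flat `ℓ²`-stencil of the bond graph (`0 < λ`), and suppose `‖f(p)‖ + ‖q(p)‖ ≤ s·λ·W(p)` (`0 ≤ s`).  Then
`‖u(p₀)‖ ≤ s·Σ_{l<3}(1∕λ)^l + √(3³∕(c₀·(L^{K−n})³)·(λ³)⁻¹)·√(Σ_p c₀‖u(p)‖²∕W(p))` — §2 at the Kato form `katoForm_of_laplaceA`.  V3's site theorem, bond twin.
CONDITIONAL on the displayed weight and data letters. [cite: Balaban1985BackgroundPropagators, Thm 3.1 (3.42) p.397, (3.23)–(3.25) p.394, (3.11) p.392, Thm 3.12 p.422;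
Balaban1985Variational, (134)–(136) p.298; Balaban1984PropagatorsI, (1.29) p.23, Prop. 1.1 p.33, p.36] -/
theorem norm_apply_le_of_kato_oneForm_weighted (hnK : n ≤ K) (U₀ : GaugeField (F.P K) 0 (Matrix.specialUnitaryGroup (Fin 2) ℂ))
    {u f : BondL2K ℂ 3 (periodsT3 F K) c₀ W₂} (hu : laplaceA F n K h c₀ cB a Δx U₀ u = f)
    {q : Bond 3 (periodsT3 F K) → W₂}
    (hq : ∀ p, q p = WL2.equiv ℂ _ W₂ (LinearMap.adjoint (Qk F n K h c₀ cB U₀) (((a : ℝ) : ℂ) • Qk F n K h c₀ cB U₀ u)) p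
      - WL2.equiv ℂ _ W₂ (DL2 F n K c₀ U₀ (DstarL2 F n K c₀ U₀ u - RS F n K h c₀ cB U₀ (DstarL2 F n K c₀ U₀ u))) p
      + WL2.equiv ℂ _ W₂ ((Δx U₀ - (DeltaEta F n K c₀ U₀ : BondL2K ℂ 3 (periodsT3 F K) c₀ W₂ →ₗ[ℂ] BondL2K ℂ 3 (periodsT3 F K) c₀ W₂)) u) p
      + frobEquiv.symm ((eta F n K)⁻¹ • (eta F n K)⁻¹ •
          (deltaPrimeOp (torusT (F.P K) 0) (fun ν x => bgUnits F K U₀ ⟨x, ν⟩) 1 (formComp ((toL2 F K c₀).symm u)) p.2 ((siteEquiv F K).symm p.1)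
            - curvOp (torusT (F.P K) 0) (fun ν x => bgUnits F K U₀ ⟨x, ν⟩) (formComp ((toL2 F K c₀).symm u)) p.2 ((siteEquiv F K).symm p.1))))
    {W : Bond 3 (periodsT3 F K) → ℝ} {lam : ℝ} (hlam : 0 < lam) (hW : ∀ p, 0 < W p)
    (hsup : ∀ p, lam * W p ≤ ∑ j : Fin 3 ⊕ Fin 3, (eta F n K)⁻¹ ^ 2 * (W p - W (Sum.elim (fun ν => unshift ν p.1) (fun ν => shift ν p.1) j, p.2)) + 1 * W p)
    {s : ℝ} (hs : 0 ≤ s) (hdata : ∀ p, ‖WL2.equiv ℂ _ W₂ f p‖ + ‖q p‖ ≤ s * (lam * W p))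
    {p₀ : Bond 3 (periodsT3 F K)} (hp₀ : W p₀ = 1) :
    ‖WL2.equiv ℂ _ W₂ u p₀‖ ≤ s * ∑ l ∈ Finset.range 3, (1 / lam) ^ l
        + Real.sqrt (3 ^ 3 / (c₀ * ((F.L : ℝ) ^ (K - n)) ^ 3) * (lam ^ 3)⁻¹) * Real.sqrt (∑ p, c₀ * ‖WL2.equiv ℂ _ W₂ u p‖ ^ 2 / W p) :=
  norm_apply_le_of_katoForm_bond_weighted F n K c₀ hnK U₀ (u := fun p => WL2.equiv ℂ _ W₂ u p) (f := fun p => WL2.equiv ℂ _ W₂ f p) (q := q)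
    (fun p => katoForm_of_laplaceA F n K c₀ U₀ hu hq p) hlam hW hsup hs hdata hp₀

/-- ★★ **THE MEMBER EDITION WITH THE (D-E) SLOT AS ONE LETTER**: same data; if moreover `√(Σ_p c₀‖u(p)‖²∕W(p)) ≤ E_W` (the letter O4 feeds from the `L²` BLOCK DECAY of the solution
operator and the weight's block-distance domination), then `‖u(p₀)‖ ≤ s·Σ_{l<3}(1∕λ)^l + √(3³∕(c₀·(L^{K−n})³)·(λ³)⁻¹)·E_W` — the two-rate shape once `s` and `E_W` carry
`e^{−a·d(p₀, supp f)}`.  CONDITIONAL on the displayed letters. [cite: Balaban1985BackgroundPropagators, Thm 3.1 (3.42) p.397, (3.11) p.392, Thm 3.12 p.422;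
Balaban1984PropagatorsI, Prop. 1.1 p.33, p.36] -/
theorem norm_apply_le_of_kato_oneForm_weighted_of_letter (hnK : n ≤ K) (U₀ : GaugeField (F.P K) 0 (Matrix.specialUnitaryGroup (Fin 2) ℂ))
    {u f : BondL2K ℂ 3 (periodsT3 F K) c₀ W₂} (hu : laplaceA F n K h c₀ cB a Δx U₀ u = f)
    {q : Bond 3 (periodsT3 F K) → W₂}
    (hq : ∀ p, q p = WL2.equiv ℂ _ W₂ (LinearMap.adjoint (Qk F n K h c₀ cB U₀) (((a : ℝ) : ℂ) • Qk F n K h c₀ cB U₀ u)) p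
      - WL2.equiv ℂ _ W₂ (DL2 F n K c₀ U₀ (DstarL2 F n K c₀ U₀ u - RS F n K h c₀ cB U₀ (DstarL2 F n K c₀ U₀ u))) p
      + WL2.equiv ℂ _ W₂ ((Δx U₀ - (DeltaEta F n K c₀ U₀ : BondL2K ℂ 3 (periodsT3 F K) c₀ W₂ →ₗ[ℂ] BondL2K ℂ 3 (periodsT3 F K) c₀ W₂)) u) p
      + frobEquiv.symm ((eta F n K)⁻¹ • (eta F n K)⁻¹ •
          (deltaPrimeOp (torusT (F.P K) 0) (fun ν x => bgUnits F K U₀ ⟨x, ν⟩) 1 (formComp ((toL2 F K c₀).symm u)) p.2 ((siteEquiv F K).symm p.1)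
            - curvOp (torusT (F.P K) 0) (fun ν x => bgUnits F K U₀ ⟨x, ν⟩) (formComp ((toL2 F K c₀).symm u)) p.2 ((siteEquiv F K).symm p.1))))
    {W : Bond 3 (periodsT3 F K) → ℝ} {lam : ℝ} (hlam : 0 < lam) (hW : ∀ p, 0 < W p)
    (hsup : ∀ p, lam * W p ≤ ∑ j : Fin 3 ⊕ Fin 3, (eta F n K)⁻¹ ^ 2 * (W p - W (Sum.elim (fun ν => unshift ν p.1) (fun ν => shift ν p.1) j, p.2)) + 1 * W p)
    {s : ℝ} (hs : 0 ≤ s) (hdata : ∀ p, ‖WL2.equiv ℂ _ W₂ f p‖ + ‖q p‖ ≤ s * (lam * W p))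
    {p₀ : Bond 3 (periodsT3 F K)} (hp₀ : W p₀ = 1)
    {EW : ℝ} (hEW : Real.sqrt (∑ p, c₀ * ‖WL2.equiv ℂ _ W₂ u p‖ ^ 2 / W p) ≤ EW) :
    ‖WL2.equiv ℂ _ W₂ u p₀‖ ≤ s * ∑ l ∈ Finset.range 3, (1 / lam) ^ l + Real.sqrt (3 ^ 3 / (c₀ * ((F.L : ℝ) ^ (K - n)) ^ 3) * (lam ^ 3)⁻¹) * EW := by
  have h := norm_apply_le_of_kato_oneForm_weighted F n K c₀ hnK U₀ hu hq hlam hW hsup hs hdata hp₀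
  exact h.trans (add_le_add_right (mul_le_mul_of_nonneg_left hEW (Real.sqrt_nonneg _)) _)

end Summit.QuantumFields.YangMills.Theorems.Prop7OneFormKatoBootstrapDecay

end
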